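import Summits.QuantumFields.GaugeBoot.WeakCouplingRate
import Summits.QuantumFields.GaugeBoot.SU2WeakCouplingWindow
import Summits.QuantumFields.GaugeBoot.LimitPoints
import HarnessLib

/-!
# Gauge-boot: the weak-coupling rate for `SU(N)`, EVERY `N`, in the cell's vocabulary — uniform in the
# volume, at every infinite-volume limit point, and as analytic shape-(A) windows
# (large-`N` supplement 18, part 3)

HONEST FRAMING (cell `pub-gaugeboot`, page 1 of every file): certified bounds on lattice
expectations at STATED coupling, gauge group, dimension and torus size; NOT a mass gap, NOT a
continuum limit, NOT a string tension, NOT large `N`; NOT Yang–Mills-summit-bearing (barriers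
`FixedCouplingUltralocality`, `PerturbativeInvisibility`).  ASYMPTOTIC statements: at the couplings of
the cell's tables (`β_std ≤ 10`) every right-hand side below exceeds `1` and says nothing (e.g. `SU(3)`,
`D = 4`: the window's lower end is positive only for `β_std ≳ 150`); the power of `log β` is not sharp and the
constant `4N²/(D−1)` comes from the ambient dimension `2N²` of the covering bound, not from `dim SU(N)`.
No number of CERTIFIED.md is certified here.

## Content (`β_std` = standard Wilson coupling, tree coupling `β_std/N`)

* ★★★ `SUNRate.one_sub_plaquetteExpectation_le` — for EVERY `N ≥ 1`, `D ≥ 2`, EVERY torus side `L` and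
  `β_std ≥ N`:
  `1 − plaquetteExpectation N D L β_std ≤ (2 + (4N²/(D−1))·(log(144N²) + log(β_std/N)))/β_std`;
  the cell's `SU(3)` rows: `one_sub_plaquetteExpectation_three_three_le` (`D = 3`: `(2 + 18(log 1296 + log(β/3)))/β`),
  `one_sub_plaquetteExpectation_three_four_le` (`D = 4`: `(2 + 12(log 1296 + log(β/3)))/β`);
* ★★★ `SUNRate.one_sub_integral_plaquette_le_of_mem_limitPoints` — the same bound for
  `1 − ∫ (1/N) Re tr U_P dμ` at EVERY infinite-volume limit point `μ` of the `SU(N)` torus states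
  (`infiniteVolumeLimitPoints (suRep N) (β_std/N)`, any subsequence of sides) and every plaquette of `ℤ^D`;
* ★★ `SUNRate.plaquetteWindow_weakCoupling` — the analytic shape-(A) window
  `PlaquetteWindow N D L₀ β_std (1 − (2 + (4N²/(D−1))(log(144N²) + log(β_std/N)))/β_std) 1` for all `L₀`.

Together with supplement 16 (`TorusWilsonLoopStrict`/`DLRWilsonLoopStrict`: `⟨ū_P⟩ < 1`) and A17
(monotone envelope) this brackets the `SU(N)` plaquette at weak coupling between `1 − O_N(log β/β)` and `1`
on every torus and at every limit point, for every `N`.  [folklore]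
-/

noncomputable section

open MeasureTheory Filter Topology
open Literature.MathematicalPhysics.QuantumFieldTheory
open Literature.MathematicalPhysics.QuantumLattice (LGConfig plaquetteObs plaquetteHolonomyZd IsCylinder
  IsInfiniteVolumeLimitAlong infiniteVolumeLimitPoints fundamentalRep_apply)
open Literature.RepresentationTheory.CompactGroups

namespace Summit.QuantumFields.GaugeBoot

namespace SUNRate

/-! ## The cell's `plaquetteExpectation N D L β_std`, every `N` -/

/-- ★★★ **Weak-coupling rate for `SU(N)`, every `N`, uniformly in the volume.**  For `N ≥ 1`, `D ≥ 2`,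
EVERY torus side `L` and every `β_std ≥ N`:
`1 − plaquetteExpectation N D L β_std ≤ (2 + (4N²/(D−1))·(log(144N²) + log(β_std/N)))/β_std`. [folklore] -/
theorem one_sub_plaquetteExpectation_le {N D L : ℕ} [NeZero L] (hN : N ≠ 0) (hD : 2 ≤ D) {β : ℝ}
    (hβ : (N : ℝ) ≤ β) :
    1 - plaquetteExpectation N D L β ≤
      (2 + 4 * (N : ℝ) ^ 2 / ((D : ℝ) - 1) * (Real.log (144 * (N : ℝ) ^ 2) + Real.log (β / N))) / β := by
  have hN' : (0 : ℝ) < N := by exact_mod_cast Nat.pos_of_ne_zero hN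
  have hβ' : (1 : ℝ) ≤ β / N := by rw [le_div_iff₀ hN']; linarith
  have h := WeakCoupling.one_sub_wilsonExpectation_meanPlaquette_le (d := D) (L := L) (suRep N) (continuous_suRep N)
    hN hD hβ'
  unfold plaquetteExpectation
  refine h.trans (le_of_eq ?_)
  have hβ0 : 0 < β := by linarith
  have hD' : ((D : ℝ) - 1) ≠ 0 := by
    have : (2 : ℝ) ≤ D := by exact_mod_cast hD
    linarith
  field_simp

/-- The cell's `T3` group and dimension (`SU(3)`, `D = 3`): for every `L` and `β_std ≥ 3`,
`1 − plaquetteExpectation 3 3 L β_std ≤ (2 + 18·(log 1296 + log(β_std/3)))/β_std`. [folklore] -/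
theorem one_sub_plaquetteExpectation_three_three_le {L : ℕ} [NeZero L] {β : ℝ} (hβ : 3 ≤ β) :
    1 - plaquetteExpectation 3 3 L β ≤ (2 + 18 * (Real.log 1296 + Real.log (β / 3))) / β := by
  have h := one_sub_plaquetteExpectation_le (N := 3) (D := 3) (L := L) (by norm_num) (by norm_num) (by exact_mod_cast hβ)
  refine h.trans (le_of_eq ?_)
  norm_num

/-- The cell's `T4` group and dimension (`SU(3)`, `D = 4`): for every `L` and `β_std ≥ 3`,
`1 − plaquetteExpectation 3 4 L β_std ≤ (2 + 12·(log 1296 + log(β_std/3)))/β_std`. [folklore] -/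
theorem one_sub_plaquetteExpectation_three_four_le {L : ℕ} [NeZero L] {β : ℝ} (hβ : 3 ≤ β) :
    1 - plaquetteExpectation 3 4 L β ≤ (2 + 12 * (Real.log 1296 + Real.log (β / 3))) / β := by
  have h := one_sub_plaquetteExpectation_le (N := 3) (D := 4) (L := L) (by norm_num) (by norm_num) (by exact_mod_cast hβ)
  refine h.trans (le_of_eq ?_)
  norm_num

/-! ## Analytic shape-(A) windows -/

/-- ★★ **Analytic weak-coupling windows for `SU(N)`, every `N`**: for `N ≥ 1`, `D ≥ 2`, `β_std ≥ N` and
every `L₀`, the shape-(A) window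
`PlaquetteWindow N D L₀ β_std (1 − (2 + (4N²/(D−1))(log(144N²) + log(β_std/N)))/β_std) 1` holds
(for ALL torus sides, even or odd). [folklore] -/
theorem plaquetteWindow_weakCoupling {N D : ℕ} (hN : N ≠ 0) (hD : 2 ≤ D) (L₀ : ℕ) {β : ℝ} (hβ : (N : ℝ) ≤ β) :
    PlaquetteWindow N D L₀ β
      (1 - (2 + 4 * (N : ℝ) ^ 2 / ((D : ℝ) - 1) * (Real.log (144 * (N : ℝ) ^ 2) + Real.log (β / N))) / β) 1 := by
  intro L _ _ _
  refine ⟨?_, SU2Rate.plaquetteExpectation_le_one' N D L β⟩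
  have h := one_sub_plaquetteExpectation_le (N := N) (D := D) (L := L) hN hD hβ
  linarith

/-! ## Infinite-volume limit points -/

/-- ★★★ **The rate at every infinite-volume limit point, every `N`.**  For `N ≥ 1`, `D ≥ 2`, `β_std ≥ N`,
every `μ ∈ infiniteVolumeLimitPoints (suRep N) (β_std/N)` (any subsequence of torus sides) and every
plaquette `(x; i ≠ j)` of `ℤ^D`:
`1 − ∫ (1/N) Re tr U_P dμ ≤ (2 + (4N²/(D−1))(log(144N²) + log(β_std/N)))/β_std`. [folklore] -/
theorem one_sub_integral_plaquette_le_of_mem_limitPoints {N D : ℕ} (hN : N ≠ 0) (hD : 2 ≤ D) {β : ℝ}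
    (hβ : (N : ℝ) ≤ β) {μ : Measure (LGConfig D (SU N))}
    (hμ : μ ∈ infiniteVolumeLimitPoints (d := D) (suRep N) (β / N))
    (x : Literature.Probability.LatticeModels.Site D) {i j : Fin D} (hij : i ≠ j) :
    1 - ∫ U, (N : ℝ)⁻¹ * plaquetteObs (suRep N) x i j U ∂μ ≤
      (2 + 4 * (N : ℝ) ^ 2 / ((D : ℝ) - 1) * (Real.log (144 * (N : ℝ) ^ 2) + Real.log (β / N))) / β := by
  obtain ⟨Lk, hmono, hlim⟩ := hμ
  have hNpos : (0 : ℝ) < N := by exact_mod_cast Nat.pos_of_ne_zero hN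
  set F : LGConfig D (SU N) → ℝ := fun U => (N : ℝ)⁻¹ * plaquetteObs (suRep N) x i j U with hF
  have hcyl : IsCylinder F ({(x, i), (x + Pi.single i 1, j), (x + Pi.single j 1, i), (x, j)} :
      Finset (Literature.MathematicalPhysics.QuantumLattice.ZdEdge D)) := by
    intro U V hUV
    simp only [hF, plaquetteObs, plaquetteHolonomyZd]
    rw [hUV (x, i) (by simp), hUV (x + Pi.single i 1, j) (by simp), hUV (x + Pi.single j 1, i) (by simp),
      hUV (x, j) (by simp)]
  have hcont : Continuous F := by
    have h1 : Continuous fun U : LGConfig D (SU N) => plaquetteHolonomyZd U x i j := by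
      unfold plaquetteHolonomyZd; fun_prop
    exact continuous_const.mul ((continuous_trace_re (suRep N) (continuous_suRep N)).comp h1)
  have hbd : ∃ C, ∀ U, |F U| ≤ C := by
    refine ⟨1, fun U => ?_⟩
    have h := CompactGroup.abs_re_trace_le_card (suRep N) (continuous_suRep N) (plaquetteHolonomyZd U x i j)
    rw [Fintype.card_fin] at h
    simp only [hF, plaquetteObs]
    rw [abs_mul, abs_inv, Nat.abs_cast]
    calc (N : ℝ)⁻¹ * |((suRep N) (plaquetteHolonomyZd U x i j)).trace.re| ≤ (N : ℝ)⁻¹ * N := by gcongr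
      _ = 1 := inv_mul_cancel₀ hNpos.ne'
  have htend := hlim.2 F _ hcyl hcont hbd
  have hFt : ∀ L : ℕ, Literature.MathematicalPhysics.QuantumLattice.toTorusObservable L F =
      plaquetteTrace (suRep N) (Literature.Probability.LatticeModels.Torus.proj L x) i j := fun L =>
    toTorusObservable_plaquetteObs (suRep N) L x i j
  simp only [hFt] at htend
  -- on every torus the single-plaquette expectation is the mean plaquette, bounded below uniformly in `L`
  have hev : ∀ k : ℕ,
      1 - (2 + 4 * (N : ℝ) ^ 2 / ((D : ℝ) - 1) * (Real.log (144 * (N : ℝ) ^ 2) + Real.log (β / N))) / β ≤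
      wilsonExpectation (suRep N) (β / N)
        (plaquetteTrace (suRep N) (Literature.Probability.LatticeModels.Torus.proj (Lk k + 1) x) i j) := by
    intro k
    have h := one_sub_plaquetteExpectation_le (N := N) (D := D) (L := Lk k + 1) hN hD hβ
    unfold plaquetteExpectation at h
    rw [wilsonExpectation_meanPlaquette_eq_plaquetteTrace (suRep N) (continuous_suRep N) (β / N)
      (Literature.Probability.LatticeModels.Torus.proj (Lk k + 1) x) hij] at h
    linarith
  have hge := ge_of_tendsto htend (Filter.Eventually.of_forall hev)
  linarith

/-- The same along a named subsequence (`IsInfiniteVolumeLimitAlong`). [folklore] -/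
theorem one_sub_integral_plaquette_le_of_limitAlong {N D : ℕ} (hN : N ≠ 0) (hD : 2 ≤ D) {β : ℝ}
    (hβ : (N : ℝ) ≤ β) {Lk : ℕ → ℕ} (hmono : StrictMono Lk) {μ : Measure (LGConfig D (SU N))}
    (hμ : IsInfiniteVolumeLimitAlong (suRep N) (β / N) Lk μ)
    (x : Literature.Probability.LatticeModels.Site D) {i j : Fin D} (hij : i ≠ j) :
    1 - ∫ U, (N : ℝ)⁻¹ * plaquetteObs (suRep N) x i j U ∂μ ≤
      (2 + 4 * (N : ℝ) ^ 2 / ((D : ℝ) - 1) * (Real.log (144 * (N : ℝ) ^ 2) + Real.log (β / N))) / β :=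
  one_sub_integral_plaquette_le_of_mem_limitPoints hN hD hβ ⟨Lk, hmono, hμ⟩ x hij

end SUNRate

end Summit.QuantumFields.GaugeBoot

end
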